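import Literature.NumberTheory.Automorphic.Liu2021.AppendixB.PolesEisensteinThetaLifting
import Literature.NumberTheory.Automorphic.FiniteMultiplicityCriterion
import Literature.NumberTheory.Automorphic.AsaiAtOneRankOne
import HarnessLib

/-!
# Liu 2021, Appendix B — discharges of the definitional named facts of ★ `PolesEisensteinThetaLifting`

Proof file (theorems only: no definition, no named fact, no instance, no `sorry`), sibling of the
statement-only carpet ★ `Literature/NumberTheory/Automorphic/Liu2021/AppendixB/PolesEisensteinThetaLifting.lean`
[Liu2021, App. B, print pp. 95–106].  Of that carpet's three CLOSED named facts, two are one-step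
applications of a tree theorem and are discharged here (ED. 1), statements byte-unchanged:

* `cuspMultiplicity_le_discMultiplicity_holds` — «`m_cusp(π) ≤ m_disc(π)`» (sentence after Def. B.1, p. 96 L20):
  the multiplicity of `π` inside the closed subrepresentation `L²_cusp ≤ L²` is at most its multiplicity in `L²`,
  which is ★ `ContRepresentation.ClosedSubrep.multiplicity_toContRep_le` (`FiniteMultiplicityCriterion`; Dixmier §5.4).
* `remB3_isUnitary_holds` — Rem. B.3, first sentence (p. 96 L37): «a strictly unitary automorphic character is unitary»,
  which is ★ `HeckeCharacter.isUnitary_of_map_posRealIdele` (`AsaiAtOneRankOne`: `𝕀_E = 𝕀_E¹ · ℝ_{>0}` and `𝕀_E¹/E^×`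
  compact), valid for every number field (the carpet's CM hypothesis is not used).

The third CLOSED named fact, a genuine (short) argument rather than a one-step application, is discharged
in ED. 2 of this file, statement byte-unchanged:

* `remB3_existsUnique_twist_holds` — Rem. B.3, second sentence (p. 96 L38–40): «for every automorphic character
  `μ` of `𝔸_E^×` there exists a unique complex number `s` such that `μ|·|_E^s` is strictly unitary».  Proof as
  in Tate's thesis §4.3 (the quasi-characters of `ℝ_{>0}` are the `r ↦ r^z`, `z` unique): on the diagonal
  `ρ(r)` = ★ `posRealIdele E r` one has `μ(ρ(r)) = r^z` for some `z ∈ ℂ` (★ `HeckeCharacter.exists_cpow_eq_map_posRealIdele`)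
  and `‖ρ(r)‖_E = r^{[E:ℚ]}` (★ `ideleNorm_posRealIdele_holds`), so `s := −z/[E:ℚ]` works, and it is the only
  one because `R ↦ R^w` (`R > 0`) determines `w` (★ `eq_of_forall_ofReal_cpow_eq`).  Valid for every number
  field (the carpet's CM hypothesis is not used).

## References
* [Liu2021] Y. Liu, *Fourier–Jacobi cycles and arithmetic relative trace formula*, Camb. J. Math. 9 (2021) 1–147,
  App. B §B.1, Def. B.1 and Rem. B.3 (p. 96).
* [Dixmier1977] J. Dixmier, *C\*-algebras* (1977), §5.4 (multiplicities of subrepresentations).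
* [CasselsFrohlichANT1967] Cassels–Fröhlich (eds.), *Algebraic Number Theory* (1967), Ch. II §16 Theorem (`𝕀¹/K^×` compact).
* [TateThesis1967] J. Tate, *Fourier analysis in number fields and Hecke's zeta-functions* (thesis 1950), in
  Cassels–Fröhlich (1967), §4.3 (quasi-characters trivial on `𝕀¹` are `|·|^s`, `s` uniquely determined).
-/

noncomputable section

open scoped NNReal

namespace Literature.NumberTheory.Automorphic.Liu2021.AppendixB.PolesEisensteinThetaLifting

/-- **«`0 ≤ m_cusp(π) ≤ m_disc(π)`» holds** (sentence after Def. B.1): discharge of the named fact ★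
`cuspMultiplicity_le_discMultiplicity` — a finite orthogonal family of irreducible closed subrepresentations of
`L²_cusp` equivalent to `π` is such a family in `L²`, i.e. ★ `ContRepresentation.ClosedSubrep.multiplicity_toContRep_le`
applied to the closed subrepresentation `𝒞.cusp ≤ L²(G(𝔸_K) ⧸ A_G G(K), μ)`.
[cite: Liu2021, App. B §B.1, sentence after Def. B.1 (p. 96 L20)] [cite: Dixmier1977, §5.4] -/
theorem cuspMultiplicity_le_discMultiplicity_holds : cuspMultiplicity_le_discMultiplicity := by
  intro K _ _ 𝒢 μ _ 𝒞 H _ _ π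
  exact 𝒞.cusp.multiplicity_toContRep_le π

/-- **Remark B.3, first sentence, holds**: a strictly unitary automorphic (quasi-)character of `𝔸_E^×` is unitary —
discharge of the named fact ★ `remB3_isUnitary` by ★ `HeckeCharacter.isUnitary_of_map_posRealIdele` (a Hecke character
trivial on the positive real diagonal ideles `posRealIdele E r` has absolute value `1`: `𝕀_E = 𝕀_E¹ · ℝ_{>0}` and
`𝕀_E¹ / E^×` is compact).  The CM hypothesis of the carpet's statement is not needed.
[cite: Liu2021, Rem. B.3 (p. 96 L37)] [cite: CasselsFrohlichANT1967, Ch. II §16 Theorem] -/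
theorem remB3_isUnitary_holds : remB3_isUnitary := by
  intro E _ _ _ μ hμ
  exact GaloisRepresentations.HeckeCharacter.isUnitary_of_map_posRealIdele hμ

/-- **Remark B.3, second sentence, holds**: for every automorphic (quasi-)character `μ` of `𝔸_E^×` there is a
unique `s ∈ ℂ` with `μ|·|_E^s` strictly unitary, i.e. `μ(ρ(r)) · ‖ρ(r)‖_E^s = 1` for all `r > 0` on the positive
real diagonal `ρ(r)` = ★ `posRealIdele E r` — discharge of the named fact ★ `remB3_existsUnique_twist`.
Proof (Tate's thesis §4.3): `μ(ρ(r)) = r^z` for some `z ∈ ℂ` (★ `HeckeCharacter.exists_cpow_eq_map_posRealIdele`,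
a continuous homomorphism `ℝ_{>0} → ℂˣ` is a complex power) and `‖ρ(r)‖_E = r^{[E:ℚ]}` (★ `ideleNorm_posRealIdele_holds`),
so `s := −z/[E:ℚ]` satisfies `r^z · (r^{[E:ℚ]})^s = r^z · r^{−z} = 1`; if `s'` also does, then
`R^{[E:ℚ]s'} = R^{[E:ℚ]s}` for every real `R > 0`, whence `[E:ℚ]s' = [E:ℚ]s` (★ `eq_of_forall_ofReal_cpow_eq`) and
`s' = s`.  The CM hypothesis of the carpet's statement is not needed.
[cite: Liu2021, Rem. B.3 (p. 96 L38–40)] [cite: TateThesis1967, §4.3 (remark before §4.4)] -/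
theorem remB3_existsUnique_twist_holds : remB3_existsUnique_twist := by
  intro E _ _ _ μ
  obtain ⟨z, hz⟩ := μ.exists_cpow_eq_map_posRealIdele
  set d : ℕ := Module.finrank ℚ E with hd
  have hd0 : (d : ℂ) ≠ 0 := Nat.cast_ne_zero.mpr Module.finrank_pos.ne'
  -- positivity of the real coordinate of `r ∈ ℝ_{>0}`
  have hr0 : ∀ r : NNRealˣ, (0 : ℝ) < ((r : NNReal) : ℝ) := fun r =>
    NNReal.coe_pos.mpr (pos_iff_ne_zero.mpr r.ne_zero)
  -- `‖ρ(r)‖_E = r ^ [E:ℚ]`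
  have hN : ∀ r : NNRealˣ,
      (GaloisRepresentations.ideleNorm (posRealIdele E r) : ℂ) = (((r : NNReal) : ℝ) : ℂ) ^ (d : ℕ) := by
    intro r
    rw [← coe_ideleNorm, ideleNorm_posRealIdele_holds E r, NNReal.coe_pow, Complex.ofReal_pow]
  -- `(r ^ [E:ℚ]) ^ s = r ^ ([E:ℚ] s)` for a positive real base
  have hpow : ∀ (r : NNRealˣ) (s : ℂ),
      ((((r : NNReal) : ℝ) : ℂ) ^ (d : ℕ)) ^ s = (((r : NNReal) : ℝ) : ℂ) ^ ((d : ℂ) * s) := by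
    intro r s
    have hr : (0 : ℝ) ≤ ((r : NNReal) : ℝ) := NNReal.coe_nonneg _
    rw [← Complex.cpow_natCast, ← Complex.cpow_mul]
    · rw [← Complex.ofReal_log hr, ← Complex.ofReal_natCast, ← Complex.ofReal_mul, Complex.ofReal_im]
      exact neg_lt_zero.mpr Real.pi_pos
    · rw [← Complex.ofReal_log hr, ← Complex.ofReal_natCast, ← Complex.ofReal_mul, Complex.ofReal_im]
      exact Real.pi_pos.le
  -- existence: `s := -z/[E:ℚ]`
  have hex : ∀ r : NNRealˣ,
      (μ (posRealIdele E r) : ℂ) * ((GaloisRepresentations.ideleNorm (posRealIdele E r) : ℂ) ^ (-(z / d))) = 1 := by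
    intro r
    have hrz : (((r : NNReal) : ℝ) : ℂ) ^ z ≠ 0 := fun h =>
      (hr0 r).ne' (Complex.ofReal_eq_zero.mp ((Complex.cpow_eq_zero_iff _ _).mp h).1)
    rw [hz r, hN r, hpow, mul_neg, mul_div_cancel₀ _ hd0, Complex.cpow_neg, mul_inv_cancel₀ hrz]
  refine ⟨-(z / d), hex, fun s hs => ?_⟩
  -- uniqueness: `R ^ ([E:ℚ] s) = R ^ ([E:ℚ] s₀)` for all `R > 0`
  have key : (d : ℂ) * s = (d : ℂ) * (-(z / d)) := by
    refine GaloisRepresentations.eq_of_forall_ofReal_cpow_eq fun R hR => ?_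
    have hne : R.toNNReal ≠ 0 := fun h0 => hR.not_ge (Real.toNNReal_eq_zero.mp h0)
    set r : NNRealˣ := Units.mk0 _ hne with hr
    have hRr : (((r : NNReal) : ℝ) : ℂ) = (R : ℂ) := by
      rw [hr, Units.val_mk0, Real.coe_toNNReal R hR.le]
    have h1 := hs r
    rw [← hex r] at h1
    have h2 := mul_left_cancel₀ (Units.ne_zero _) h1
    rwa [hN r, hpow, hpow, hRr] at h2
  exact mul_left_cancel₀ hd0 key

end Literature.NumberTheory.Automorphic.Liu2021.AppendixB.PolesEisensteinThetaLifting

end
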